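import Summits.QuantumFields.YangMills.Theses.StretchedTail

/-!
# Assembly of route `StretchedTail` (rung R3 of LADDER-YM; ideator seat ym-r3-idea-2 g4, LINE 7)

The route file's kernel-checked deciding theorem `closes` packaged as the proof of the route's `Assembly` item:
`MinimiserStabilityRegPr → FluctuationComparisonRegPrIntL → OrliczTailL → HistoryTailOfOrlicz → YM3TorusSU2`.
No summit and no Clay statement is proved here; the rung `YM3TorusSU2` itself stays open behind the open cruxes
(`OrliczTailL` new; `MinimiserStabilityRegPr` / `FluctuationComparisonRegPrIntL` the parent route's residuals).
-/

namespace Summit.QuantumFields.YangMills.Theorems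

open Summit.QuantumFields.YangMills.Theses.StretchedTail in
/-- The `Assembly` item of route `StretchedTail` holds: it is the route's deciding theorem `closes` read as an implication. -/
theorem stretchedTail_assembly : Summit.QuantumFields.YangMills.Theses.StretchedTail.Assembly :=
  fun h200 h201 hX hG => closes h200 h201 hX hG

end Summit.QuantumFields.YangMills.Theorems
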